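import Literature.IUT.HodgeArakelov.EtaleThetaDataYdduuIndex
import Literature.AnabelianGeometry.EtaleTheta.Discharge.Sec1DeckSign
import Literature.AnabelianGeometry.EtaleTheta.Discharge.Sec1TranslatesNonTorsion

/-!
# (R2) `hsign` and (R3) `hfree` of [IUTchII] Prop 2.2 (ii) at the model, from the [EtTh] §1 named facts

Mochizuki, *The étale theta function …*, Publ. RIMS **45** (2009): Prop. 1.4 (ii) p. 20, Prop. 1.5 (ii)(iii)
p. 23, Def. 2.7 p. 41 [cite: MochizukiEtTh2009, Prop 1.5 (iii) p.23]; consumer: [IUTchII] Prop. 2.2 (ii) at the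
model, `Literature.IUT.HodgeArakelov.prop22_ii'_model` (abc-iut-w4-d010, p414140), binders (R2) `hsign` and (R3)
`hfree` [cite: Mochizuki2012, Prop 2.2 (ii) p.66].

PROOF-ONLY companion (no definitions; cell abc-iut, seat abc-iut-L2-t8; GAP row G-w4d010-2). ASSEMBLY of
* this seat's §2 TRANSPORT `EtaleThetaDataSignTransport.lean` (p415404: `hsign_of_etaDd_sign`,
  `hfree_of_etaDd_free`, `not_isOfFinOrder_translate_of_etaDd` — the `l·Δ_Θ`-level binders from `Δ_Θ`-level
  class statements on `E.etaDd`), with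
* abc-iut-L2-t1's §1-LEVEL DISCHARGES `Discharge/Sec1DeckSign.lean` (`exists_sq_eq_one_and_conj_eq`: the sign
  clause (P14ii-cl) from the FACT `Prop15iii` + `K = K̈`) and `Discharge/Sec1TranslatesNonTorsion.lean` (p415695:
  `not_isOfFinOrder_comap_conj_zpow_div`: the non-torsion clause (P14iii-cl) from the FACTS `Prop15ii`,
  `Prop15iii` + one printed clause `hL` = GAP row G-L2t1-1),
using the `X̲̲`-layer inputs `hpow` (`pow_mem_map_of_origin`) and `hγ` (`toZ_ne_one_of_toLZ`) of this seat's
`EtaleThetaDataYdduuIndex.lean`. CLOSING: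
* **`hsign_of_prop15iii`** — binder `hsign` of `prop22_ii'_model` HOLDS at the model modulo the FACT `Prop15iii` by
  name (+ `Compat`, `Sec2Hyps`);
* **`not_isOfFinOrder_translate_of_prop15`**, **`hfree_of_prop15`** — binder `hfree` (and the input of d010's
  `hfree_of_translate_not_isOfFinOrder`) HOLDS at the model modulo the FACTS `Prop15ii`, `Prop15iii`, the printed
  clause `hL` (G-L2t1-1) and the freeness guard `IsEtThOrigin`, by name.
Honest framing: `Prop15ii`/`Prop15iii` are refereed [EtTh] statements consumed BY NAME (FACT-LIST policy), not
proved; the consumer's claim key `Mochizuki2012` is disputed (D-0012); nothing here bears on [IUTchIII] Cor. 3.12.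
typed ≠ proved.
-/

namespace Literature.IUT.HodgeArakelov

open Literature.AnabelianGeometry.EtaleTheta (ContH1 contCocycles)
open Literature.AnabelianGeometry.EtaleTheta
open EtaleThetaDataOfSetting

noncomputable section

namespace EtaleThetaDataOfSetting

variable {p : ℕ} [Fact p.Prime] {D : Literature.AnabelianGeometry.EtaleTheta.ThetaSetting p}
  {E : D.EtaleThetaData} {l : ℕ} (C : E.DoubleUnderline l) [hN : (PiYdd C).Normal]

/-! ## (R2) `hsign` at the model from `Prop15iii` -/

/-- **Binder (R2) `hsign` of `prop22_ii'_model` HOLDS at the model**, modulo the FACT [EtTh] Prop. 1.5 (iii)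
(`Prop15iii`, by name): for every `ε ∈ Π^tp_X̲̲ ∩ Π^tp_Y`, `ε·η̲̈^Θ = η̲̈^Θ·κ` with `κ² = 1` in
`H¹(Π_Ÿ(Π), l·Δ_Θ)`. (abc-iut-L2-t1's `exists_sq_eq_one_and_conj_eq` gives the `Δ_Θ`-level sign on `E.etaDd`;
this seat's `hsign_of_etaDd_sign` transports it.) [cite: MochizukiEtTh2009, Prop 1.5 (iii) p.23] -/
theorem hsign_of_prop15iii (hC : D.Compat) (hS : D.Sec2Hyps) (h15 : ThetaSetting.Prop15iii E hC) (ε : Pi C)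
    (hε₁ : (ε : D.PiTemp) ∈ D.GtpY) :
    ∃ κ : ContH1 (phi C) (D.lDeltaTheta l) (PiYdd C ⊓ ⊤), κ ^ 2 = 1 ∧
      ContH1.conj (phi C) (D.lDeltaTheta l) ε (rootLiftClass C) = rootLiftClass C * κ := by
  haveI := hC.GtpYdd_normal
  exact hsign_of_etaDd_sign C hS ε hε₁ (E.exists_sq_eq_one_and_conj_eq hC hS h15 hε₁ E.etaDd_mem_thetaClasses)

/-! ## (R3) `hfree` at the model from `Prop15ii`, `Prop15iii` (+ `hL`, `IsEtThOrigin`) -/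

/-- **The `γᵏ`-translates of the root class are non-torsion** (`k ≠ 0`, `γ` a `toLZ`-generator of `Π^tp_X̲̲`): the
input of abc-iut-w4-d010's `hfree_of_translate_not_isOfFinOrder`, at the model, modulo the FACTS [EtTh] Prop. 1.5
(ii) (`Prop15ii`), (iii) (`Prop15iii`), the printed clause `hL` ("`F̈¹/F̈² = Ẑ·log(Ü)`", GAP row G-L2t1-1) and the
freeness guard `IsEtThOrigin`, all by name — abc-iut-L2-t1's `not_isOfFinOrder_comap_conj_zpow_div` with this seat's
`hpow` (`pow_mem_map_of_origin`) and `hγ` (`toZ_ne_one_of_toLZ`), transported by `not_isOfFinOrder_translate_of_etaDd`.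
[cite: MochizukiEtTh2009, Prop 1.5 (iii) p.23] -/
theorem not_isOfFinOrder_translate_of_prop15 (hC : D.Compat) (hS : D.Sec2Hyps) (hO : D.IsEtThOrigin)
    (h15 : ThetaSetting.Prop15iii E hC) (h15ii : ThetaSetting.Prop15ii E.toKummerData hC)
    (hL : ∀ n : ℤ, E.logUdd ^ n ∈
      (ThetaSetting.Fdd2 : Subgroup (D.H1Theta (D.GtpYdd.map D.toTheta))) → n = 0)
    (γ : Pi C) (hγ : C.toLZ γ = Multiplicative.ofAdd 1) (k : ℤ) (hk : k ≠ 0) :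
    ¬ IsOfFinOrder (ContH1.conj (phi C) (D.lDeltaTheta l) (γ ^ k) (rootLiftClass C) * (rootLiftClass C)⁻¹) := by
  haveI := hC.GtpYdd_normal
  refine not_isOfFinOrder_translate_of_etaDd C γ (fun k' hk' => ?_) k hk
  exact E.not_isOfFinOrder_comap_conj_zpow_div hC h15 h15ii hL continuous_subtype_val
    (map_subtype_piYdd_inf_le_GtpYdd C ⊤) C.l_ne_zero (pow_mem_map_of_origin C hC hS hO)
    (toZ_ne_one_of_toLZ C γ hγ) hk' E.etaDd_mem_thetaClasses

/-- **Binder (R3) `hfree` of `prop22_ii'_model` HOLDS at the model** (its exact `h1Top`-translated shape), modulo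
the FACTS `Prop15ii`, `Prop15iii`, the printed clause `hL` (G-L2t1-1) and `IsEtThOrigin`, by name: distinct
`γ`-translates of `η̲̈^Θ` differ by non-torsion classes. [cite: MochizukiEtTh2009, Prop 1.5 (iii) p.23] -/
theorem hfree_of_prop15 (hC : D.Compat) (hS : D.Sec2Hyps) (hO : D.IsEtThOrigin)
    (h15 : ThetaSetting.Prop15iii E hC) (h15ii : ThetaSetting.Prop15ii E.toKummerData hC)
    (hL : ∀ n : ℤ, E.logUdd ^ n ∈
      (ThetaSetting.Fdd2 : Subgroup (D.H1Theta (D.GtpYdd.map D.toTheta))) → n = 0)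
    (γ : Pi C) (hγ : C.toLZ γ = Multiplicative.ofAdd 1) (m n : ℤ)
    (hmn : IsOfFinAddOrder
      ((h1Top C).symm (Additive.ofMul (ContH1.conj (phi C) (D.lDeltaTheta l) (γ ^ m) (rootLiftClass C))) -
        (h1Top C).symm (Additive.ofMul (ContH1.conj (phi C) (D.lDeltaTheta l) (γ ^ n) (rootLiftClass C))))) :
    m = n := by
  haveI := hC.GtpYdd_normal
  refine hfree_of_etaDd_free C γ (fun k hk => ?_) m n hmn
  exact E.not_isOfFinOrder_comap_conj_zpow_div hC h15 h15ii hL continuous_subtype_val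
    (map_subtype_piYdd_inf_le_GtpYdd C ⊤) C.l_ne_zero (pow_mem_map_of_origin C hC hS hO)
    (toZ_ne_one_of_toLZ C γ hγ) hk E.etaDd_mem_thetaClasses

end EtaleThetaDataOfSetting

end

end Literature.IUT.HodgeArakelov
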